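import Literature.AlgebraicGeometry.Frobenioids.ArithmeticFrobenioidThm64ivCompat
import Literature.AlgebraicGeometry.Frobenioids.ArithmeticFrobenioidThm64ivTransport
import HarnessLib

/-!
# Frobenioids I, Theorem 6.4 (iv), second clause with the compatibility `F₁ ≅ F₂`, AT THE CONSTRUCTIONS —
# modulo the TYPED cone node Cor. 4.11 (iv) (sequel of `ArithmeticFrobenioidThm64ivCompat.lean`)

Mochizuki, *The geometry of Frobenioids I: the general theory*, Kyushu J. Math. **62** (2008) 293–400, §6,
Thm. 6.4 (iv) p. 115 l. 23–29 [cite: MochizukiFrdI2008, Thm. 6.4 (iv) p.115].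

PROOF-ONLY (seat abc-iut-L1-d4 gen 5; row T64iv/L07b at the data, GAP-LEDGER G-L1t3-1): the two closers of
`ArithmeticFrobenioidThm64ivCompat.lean` with the Cor. 4.11 (iv) DATUM `(Ψ^Base, E, η, hdiv)` replaced by the
typed statement `PreFrobenioidData.Cor411iv … Ψ (rsParams …) (rsParams …)` (binder `h411iv`, the cone node
FrdI:Cor4.11(iv) at THE `R`-data), unpacked by abc-iut-L1-d7's `exists_transport_of_cor411iv`
(`ArithmeticFrobenioidThm64ivTransport.lean`).  Nothing here bears on [IUTchIII] Cor. 3.12.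
-/

noncomputable section

namespace Literature.AlgebraicGeometry.Frobenioids

open CategoryTheory Opposite NumberField

section Arith

variable {F₁ : Type} [Field F₁] [NumberField F₁] {K₁ : Type} [Field K₁] [Algebra F₁ K₁] [IsGalois F₁ K₁]
variable {F₂ : Type} [Field F₂] [NumberField F₂] {K₂ : Type} [Field K₂] [Algebra F₂ K₂] [IsGalois F₂ K₂]

/-- **Thm. 6.4 (iv), second clause in full, at the constructions, modulo the TYPED Cor. 4.11 (iv)** (binder
`h411iv`: abc-iut-L1-t3's `PreFrobenioidData.Cor411iv` for `Ψ` at THE `R`-data, unpacked by abc-iut-L1-d7's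
`exists_transport_of_cor411iv`), `F₁` Galois over `ℚ`. [cite: MochizukiFrdI2008, Thm. 6.4 (iv) p.115] -/
theorem Thm64iv_arith_compat_of_cor411iv [IsGalois ℚ F₁] (Ψ : arithFrobenioid F₁ K₁ ≌ arithFrobenioid F₂ K₂)
    (h411iv : PreFrobenioidData.Cor411iv (arithFrobenioidOps F₁ K₁) (arithFrobenioidOps F₂ K₂) Ψ
      (PreFrobenioid.rsParams (arithFrobenioid_isFrobenioid F₁ K₁) fun a 𝔭 => PrimarySupp a 𝔭)
      (PreFrobenioid.rsParams (arithFrobenioid_isFrobenioid F₂ K₂) fun a 𝔭 => PrimarySupp a 𝔭))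
    (B₁ : FinSubextCat F₁ K₁) (ε₁ : B₁.L ≃ₐ[F₁] F₁) :
    ∃ ΨBase : FinSubextCat F₁ K₁ ⥤ FinSubextCat F₂ K₂, ΨBase.IsEquivalence ∧
      ∀ X : FinSubextCat F₁ K₁, IsGalois ℚ X.L →
        ∃ (e : X.L ≃+* (ΨBase.obj X).L) (e₀ : F₁ ≃+* F₂),
          ∀ a : F₁, e (algebraMap F₁ X.L a) = algebraMap F₂ (ΨBase.obj X).L (e₀ a) := by
  obtain ⟨ΨBase, E, η, -, hEq, -, -, hdiv⟩ := exists_transport_of_cor411iv Ψ h411iv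
  haveI := hEq
  exact ⟨ΨBase, hEq, fun X hX => Thm64iv_arith_compat_of_isGalois_base Ψ E η hdiv B₁ ε₁ X hX⟩

/-- **`F₁ ≅ F₂` modulo the typed Cor. 4.11 (iv)**, `F₁` Galois over `ℚ`: an equivalence
`C_{K₁/F₁} ⥲ C_{K₂/F₂}` of THE arithmetic Frobenioids forces `F₁ ≅ F₂`. [cite: MochizukiFrdI2008, Thm. 6.4 (iv) p.115] -/
theorem nonempty_baseRingEquiv_arith_of_cor411iv [IsGalois ℚ F₁]
    (Ψ : arithFrobenioid F₁ K₁ ≌ arithFrobenioid F₂ K₂)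
    (h411iv : PreFrobenioidData.Cor411iv (arithFrobenioidOps F₁ K₁) (arithFrobenioidOps F₂ K₂) Ψ
      (PreFrobenioid.rsParams (arithFrobenioid_isFrobenioid F₁ K₁) fun a 𝔭 => PrimarySupp a 𝔭)
      (PreFrobenioid.rsParams (arithFrobenioid_isFrobenioid F₂ K₂) fun a 𝔭 => PrimarySupp a 𝔭))
    (B₁ : FinSubextCat F₁ K₁) (ε₁ : B₁.L ≃ₐ[F₁] F₁) : Nonempty (F₁ ≃+* F₂) := by
  obtain ⟨ΨBase, E, η, -, hEq, -, -, hdiv⟩ := exists_transport_of_cor411iv Ψ h411iv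
  haveI := hEq
  exact nonempty_baseRingEquiv_arith_of_isGalois_base Ψ E η hdiv B₁ ε₁

end Arith

end Literature.AlgebraicGeometry.Frobenioids

end
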